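import Mathlib
import HarnessLib
import Literature.Analysis.Calculus.FunctionalDependence
import Summits.NavierStokesRegularity.NavierStokesRegularity.Theorems.PoloidalWindowDoorPoloidalWindowRigidityUntwistedSeparation

/-!
# Route `PoloidalWindowDoor`, crux `PoloidalWindowRigidity` (K2, stmt-NavierStokesRegularity-19708), skeleton `lrc-jet` v5,
# stub `stub_untwisted` — brick F1: KINEMATICS OF AN UNTWISTED FOLIATION
# (twist bracket `≡ 0` ⇒ `∂₂w = P(w, y₂)`; vertical propagation of horizontal derivatives; `w = G(w|_{slice}, y₂)`)

Cell ns-regularity-ideate, seat ns-poloidal-K2-p3 (gen 6; `--supports stmt-NavierStokesRegularity-19708`, helper toward the registered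
stub `stub_untwisted` of `Cruxes/PoloidalWindowRigidity/Lines/lrc_jet.lean` v5; paper proof = `Cruxes/PoloidalWindowRigidity/UNTWISTED-NOTE.md`
§2, brick F1 of the K2 lead's `BRIEF-v5-bricks.md`).  Pure multivariable calculus on `ℝ³` (indices `0,1` horizontal, `2` the height);
no Navier–Stokes object appears.  Notation: `w : ℝ³ → ℝ` (the vertical velocity of one slice), `∂ᵢ = D(·)[eᵢ]`.

* `exists_leafwise_vertical_of_twist_eq_zero` — **F1(a), THE STRUCTURE FUNCTION OF AN UNTWISTED GERM.**  If the TWIST BRACKET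
  `{∂₂w, w}ₕ = ∂₀(∂₂w)·∂₁w − ∂₁(∂₂w)·∂₀w` vanishes near a point `a` with `∇ₕw(a) ≠ 0`, then `∂₂w(y) = P(w(y), y₂)` for all `y` near
  `a`, for a structure function `P : ℝ × ℝ → ℝ` of class `Cⁿ` at `(w a, a₂)` (functional dependence,
  `Literature.Analysis.Calculus.exists_comp_slice`, with `f = ∂₂w`, `g = w`); `eventually_contDiffAt_leaf` upgrades the regularity of
  any such structure function to the nearby leaf points `(w y, y₂)` (the hypothesis shape of the lead's F3 files
  `…UntwistedSeparation{,2}`); `fderiv_vert_vert` is the remaining chain rule **`∂₂∂₂w = Ṗ := DP(w,y₂)(P(w,y₂), 1)`** of F1(c)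
  (`∂₂E = 2P_wE` and `∂₂M = P_wM + P_wwE` are `fderiv_vert_gradSq` / `fderiv_vert_lap` of `…UntwistedSeparation`).
* `eq_zero_of_abs_deriv_le_mul_abs` — scalar linear-ODE uniqueness (Grönwall in both time directions): `|φ′| ≤ K|φ|` on a segment
  and `φ(z₀) = 0` ⇒ `φ(z₁) = 0`.
* `horizontalPairing_eq_zero_of_slice` — **VERTICAL PROPAGATION.**  If `∂₂w = P(w,y₂)` on an open `U` and the vertical segment from the
  point `y♭ = y + (z₀ − y₂)e₂` of height `z₀` to `y` lies in `U`, then for constants `α, β`: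
  `α∂₀w(y♭) + β∂₁w(y♭) = 0 ⇒ α∂₀w(y) + β∂₁w(y) = 0` — along the vertical line the pairing `φ(t) = α∂₀w + β∂₁w` solves
  `φ̇ = P_w(w,t)·φ` (`∂₂∂_bw = P_w∂_bw`, `fderiv_vert_hpartial`).  With `(α, β) = J(yₕ − c)` resp. `Jn₀` this transports a rotation /
  translation germ of `w` from ONE horizontal plane to a box (brick F5); with `(α, β) = J∇ₕw(y♭)` it is the next item.
* `exists_comp_sliceValue` — **F1(b): `w = G(u ∘ πₕ, y₂)`.**  Under `∂₂w = P(w,y₂)` on an open `U ∋ a` with `∇ₕw(a) ≠ 0`: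
  `w(y) = G(w(y♭), y₂)` for all `y` near `a` (`y♭` the vertical projection of `y` to the plane of height `a₂`), `G : ℝ × ℝ → ℝ` of class
  `Cⁿ` at `(w a, a₂)`: the bracket `{w, w ∘ ♭}ₕ` vanishes on the plane `y₂ = a₂` and is propagated by the previous item, then
  `exists_comp_slice` with `g = w ∘ ♭` (UNTWISTED-NOTE §2 "kinematic lemma", bracket form — no ODE flow is needed).

WHAT THIS IS NOT: not a claim about Navier–Stokes regularity and not the stub — kinematic bookkeeping for `stub_untwisted` (bears_on
LADDER-NS N0 via crux K2 = stmt-19708; the same lemmas serve item stmt-20428 `LrcModEntire`, whose untwisted halves they address).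
-/

noncomputable section

-- the summit and its single sub-problem share the name (CONVENTIONS §1), as in every Theorems file
set_option linter.dupNamespace false

namespace Summit.NavierStokesRegularity.NavierStokesRegularity.Theorems.PoloidalWindowDoorPoloidalWindowRigidityUntwistedKinematics

open Set Function Filter Topology Metric
open scoped ContDiff
open Literature.Analysis.Calculus
open Summit.NavierStokesRegularity.NavierStokesRegularity.Theorems.PoloidalWindowDoorPoloidalWindowRigidityConstantShearMeans
open Summit.NavierStokesRegularity.NavierStokesRegularity.Theorems.PoloidalWindowDoorLrcModEntireLeafwiseVertical
open Summit.NavierStokesRegularity.NavierStokesRegularity.Theorems.PoloidalWindowDoorPoloidalWindowRigidityUntwistedSeparation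

/-! ### F1(a): the structure function of an untwisted germ -/

/-- **F1(a) — an untwisted germ has a LEAFWISE vertical derivative.**  Let `w : ℝ³ → ℝ` and `y ↦ ∂₂w(y)` be of class `Cⁿ` at `a`
(`n ≠ 0`, `n = ω` allowed), `∇ₕw(a) ≠ 0`, and let the twist bracket `∂₀(∂₂w)·∂₁w − ∂₁(∂₂w)·∂₀w` vanish for all `y` near `a`.
Then there is `P : ℝ × ℝ → ℝ`, of class `Cⁿ` at `(w a, a₂)`, with `∂₂w(y) = P(w(y), y₂)` for all `y` near `a`
(UNTWISTED-NOTE §2: "`w_z = P(w,z,t)` locally by functional dependence"). [folklore] -/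
theorem exists_leafwise_vertical_of_twist_eq_zero {n : WithTop ℕ∞} (hn : n ≠ 0)
    {w : EuclideanSpace ℝ (Fin 3) → ℝ} {a : EuclideanSpace ℝ (Fin 3)}
    (hw : ContDiffAt ℝ n w a)
    (hw₂ : ContDiffAt ℝ n (fun y => fderiv ℝ w y (EuclideanSpace.single 2 (1 : ℝ))) a)
    (hpin : fderiv ℝ w a (EuclideanSpace.single 0 (1 : ℝ)) ≠ 0 ∨ fderiv ℝ w a (EuclideanSpace.single 1 (1 : ℝ)) ≠ 0)
    (htw : ∀ᶠ y in 𝓝 a,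
      fderiv ℝ (fun x => fderiv ℝ w x (EuclideanSpace.single 2 (1 : ℝ))) y (EuclideanSpace.single 0 (1 : ℝ)) *
          fderiv ℝ w y (EuclideanSpace.single 1 (1 : ℝ)) -
        fderiv ℝ (fun x => fderiv ℝ w x (EuclideanSpace.single 2 (1 : ℝ))) y (EuclideanSpace.single 1 (1 : ℝ)) *
          fderiv ℝ w y (EuclideanSpace.single 0 (1 : ℝ)) = 0) :
    ∃ P : ℝ × ℝ → ℝ, ContDiffAt ℝ n P (w a, a 2) ∧
      ∀ᶠ y in 𝓝 a, fderiv ℝ w y (EuclideanSpace.single 2 (1 : ℝ)) = P (w y, y 2) := by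
  rcases hpin with h0 | h1
  · -- pivot on `∂₀w(a) ≠ 0`
    obtain ⟨G, hG, hGeq⟩ := exists_comp_slice hn (b₀ := 0) (b₁ := 1) (by decide) (by decide) (by decide) hw₂ hw h0
      (htw.mono fun y hy => by linear_combination hy)
    exact ⟨G, hG, hGeq⟩
  · -- pivot on `∂₁w(a) ≠ 0`
    obtain ⟨G, hG, hGeq⟩ := exists_comp_slice hn (b₀ := 1) (b₁ := 0) (by decide) (by decide) (by decide) hw₂ hw h1
      (htw.mono fun y hy => by linear_combination -hy)
    exact ⟨G, hG, hGeq⟩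

/-- The leaf map `y ↦ (w y, y₂)` is continuous at `a` when `w` is. [folklore] -/
theorem continuousAt_leafMap {w : EuclideanSpace ℝ (Fin 3) → ℝ} {a : EuclideanSpace ℝ (Fin 3)} (hw : ContinuousAt w a) :
    ContinuousAt (fun y : EuclideanSpace ℝ (Fin 3) => (w y, y 2)) a :=
  hw.prodMk (EuclideanSpace.proj (𝕜 := ℝ) (2 : Fin 3)).continuous.continuousAt

/-- **Regularity at the nearby leaf points.**  If a structure function `P : ℝ × ℝ → ℝ` is `Cⁿ` at the base leaf point `(w a, a₂)`
(`n ≠ ∞`; `n = ω` allowed) and `w` is continuous at `a`, then `P` is `Cⁿ` at the leaf points `(w y, y₂)` of all `y` near `a` — the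
hypothesis shape `∀ y ∈ U, ContDiffAt ℝ n P (w y, y 2)` of `…UntwistedSeparation`. [folklore] -/
theorem eventually_contDiffAt_leaf {n : WithTop ℕ∞} (hn : n ≠ ∞) {P : ℝ × ℝ → ℝ}
    {w : EuclideanSpace ℝ (Fin 3) → ℝ} {a : EuclideanSpace ℝ (Fin 3)}
    (hP : ContDiffAt ℝ n P (w a, a 2)) (hw : ContinuousAt w a) :
    ∀ᶠ y in 𝓝 a, ContDiffAt ℝ n P (w y, y 2) :=
  (continuousAt_leafMap hw).tendsto.eventually (hP.eventually hn)

/-- **F1(c) — `∂₂∂₂w = Ṗ`.**  If `∂₂w = P(w,y₂)` on the open set `U` (`w ∈ C²`, `P` differentiable at the leaf points), then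
`∂₂(∂₂w)(y) = DP(w y, y₂)(P(w y, y₂), 1) = P_w·P + P_z` on `U`. [folklore] -/
theorem fderiv_vert_vert {w : EuclideanSpace ℝ (Fin 3) → ℝ} {P : ℝ × ℝ → ℝ} {U : Set (EuclideanSpace ℝ (Fin 3))}
    (hU : IsOpen U) (hw : ContDiff ℝ 2 w)
    (hPd : ∀ y ∈ U, DifferentiableAt ℝ P (w y, y 2))
    (hP : ∀ y ∈ U, fderiv ℝ w y (EuclideanSpace.single 2 (1 : ℝ)) = P (w y, y 2)) {y : EuclideanSpace ℝ (Fin 3)} (hy : y ∈ U) :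
    fderiv ℝ (fun y' => fderiv ℝ w y' (EuclideanSpace.single 2 (1 : ℝ))) y (EuclideanSpace.single 2 (1 : ℝ)) =
      fderiv ℝ P (w y, y 2) (P (w y, y 2), 1) := by
  have hwd : Differentiable ℝ w := hw.differentiable (by norm_num)
  have hS : (fun y' => fderiv ℝ w y' (EuclideanSpace.single 2 (1 : ℝ))) =ᶠ[𝓝 y] fun y' => P (w y', y' 2) := by
    filter_upwards [hU.mem_nhds hy] with y' hy' using hP y' hy'
  rw [hS.fderiv_eq, fderiv_leaf_comp_vertical (hPd y hy) (hwd y), hP y hy]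

/-! ### Scalar linear-ODE uniqueness along a segment (Grönwall, both directions) -/

/-- Forward Grönwall: `|φ′| ≤ K|φ|` on `[z₀, z₁]`, `φ(z₀) = 0`, `z₀ ≤ z₁` ⇒ `φ(z₁) = 0`.  Private helper. [folklore] -/
private theorem eq_zero_of_abs_deriv_le_mul_abs_of_le {φ : ℝ → ℝ} {K z₀ z₁ : ℝ} (hle : z₀ ≤ z₁)
    (hφ : ∀ t ∈ Icc z₀ z₁, DifferentiableAt ℝ φ t)
    (hb : ∀ t ∈ Icc z₀ z₁, |deriv φ t| ≤ K * |φ t|) (h0 : φ z₀ = 0) : φ z₁ = 0 := by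
  have hcont : ContinuousOn φ (Icc z₀ z₁) := fun t ht => (hφ t ht).continuousAt.continuousWithinAt
  have hder : ∀ t ∈ Ico z₀ z₁, HasDerivWithinAt φ (deriv φ t) (Ici t) t := fun t ht =>
    (hφ t (Ico_subset_Icc_self ht)).hasDerivAt.hasDerivWithinAt
  have hbound : ∀ t ∈ Ico z₀ z₁, ‖deriv φ t‖ ≤ K * ‖φ t‖ + 0 := fun t ht => by
    rw [add_zero, Real.norm_eq_abs, Real.norm_eq_abs]
    exact hb t (Ico_subset_Icc_self ht)
  have hδ : ‖φ z₀‖ ≤ 0 := by simp [h0]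
  have h := norm_le_gronwallBound_of_norm_deriv_right_le hcont hder hδ hbound z₁ (right_mem_Icc.2 hle)
  rw [gronwallBound_ε0_δ0] at h
  exact norm_le_zero_iff.1 h

/-- **Scalar linear-ODE uniqueness along a segment.**  If `φ : ℝ → ℝ` is differentiable at every point of the segment `[[z₀, z₁]]`
with `|φ′(t)| ≤ K|φ(t)|` there and `φ(z₀) = 0`, then `φ(z₁) = 0` (Grönwall's inequality, applied forward or, after the time
reversal `t ↦ −t`, backward). [folklore] -/
theorem eq_zero_of_abs_deriv_le_mul_abs {φ : ℝ → ℝ} {K z₀ z₁ : ℝ}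
    (hφ : ∀ t ∈ uIcc z₀ z₁, DifferentiableAt ℝ φ t)
    (hb : ∀ t ∈ uIcc z₀ z₁, |deriv φ t| ≤ K * |φ t|) (h0 : φ z₀ = 0) : φ z₁ = 0 := by
  rcases le_total z₀ z₁ with hle | hle
  · rw [uIcc_of_le hle] at hφ hb
    exact eq_zero_of_abs_deriv_le_mul_abs_of_le hle hφ hb h0
  · rw [uIcc_of_ge hle] at hφ hb
    -- time reversal: `ψ t = φ (−t)` on `[−z₀, −z₁]`
    set ψ : ℝ → ℝ := fun t => φ (-t) with hψ
    have hmem : ∀ {t : ℝ}, t ∈ Icc (-z₀) (-z₁) → -t ∈ Icc z₁ z₀ := fun ht => by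
      constructor <;> linarith [ht.1, ht.2]
    have hψd : ∀ t ∈ Icc (-z₀) (-z₁), HasDerivAt ψ (deriv φ (-t) * (-1)) t := fun t ht => by
      have h := (hφ (-t) (hmem ht)).hasDerivAt.comp t (hasDerivAt_neg t)
      exact h
    have hψ0 : ψ (-z₀) = 0 := by simp [hψ, h0]
    have h := eq_zero_of_abs_deriv_le_mul_abs_of_le (φ := ψ) (K := K) (neg_le_neg hle)
      (fun t ht => (hψd t ht).differentiableAt)
      (fun t ht => by
        rw [(hψd t ht).deriv, abs_mul, abs_neg, abs_one, mul_one]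
        exact hb (-t) (hmem ht)) hψ0
    simpa [hψ] using h

/-! ### Vertical propagation of a horizontal pairing -/

/-- The vertical line through `y`: `γ(t) = y + (t − y₂)e₂` has velocity `e₂`. [folklore] -/
theorem hasDerivAt_verticalLine (y : EuclideanSpace ℝ (Fin 3)) (t : ℝ) :
    HasDerivAt (fun t : ℝ => y + (t - y 2) • (EuclideanSpace.single 2 (1 : ℝ) : EuclideanSpace ℝ (Fin 3)))
      (EuclideanSpace.single 2 (1 : ℝ)) t := by
  have h := (((hasDerivAt_id t).sub_const (y 2)).smul_const
    (EuclideanSpace.single 2 (1 : ℝ) : EuclideanSpace ℝ (Fin 3))).const_add y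
  simpa using h

/-- **VERTICAL PROPAGATION of a horizontal pairing.**  Let `U` be open, `w ∈ C²(ℝ³)` with `∂₂w(y) = P(w(y), y₂)` on `U`, `P` of class
`C¹` at the leaf points of `U`.  Fix `y`, a height `z₀`, and constants `α, β`; suppose the vertical segment
`{y + (t − y₂)e₂ : t ∈ [[z₀, y₂]]}` lies in `U` and the pairing `α∂₀w + β∂₁w` vanishes at its foot `y♭ = y + (z₀ − y₂)e₂`.  Then it
vanishes at `y`: along the segment `φ(t) = α∂₀w + β∂₁w` solves the scalar linear ODE `φ̇ = P_w(w, t)·φ` (`∂₂∂_bw = P_w∂_bw`,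
`fderiv_vert_hpartial`), whose only solution with `φ(z₀) = 0` is `0` (UNTWISTED-NOTE §3, the transport of the planar germ to the
box: `Dw(y)[J(yₕ − c)] = 0`, `Dw(y)[Jn₀] = 0`). [folklore] -/
theorem horizontalPairing_eq_zero_of_slice {w : EuclideanSpace ℝ (Fin 3) → ℝ} {P : ℝ × ℝ → ℝ} {U : Set (EuclideanSpace ℝ (Fin 3))}
    (hU : IsOpen U) (hw : ContDiff ℝ 2 w)
    (hPd : ∀ y ∈ U, ContDiffAt ℝ 1 P (w y, y 2))
    (hP : ∀ y ∈ U, fderiv ℝ w y (EuclideanSpace.single 2 (1 : ℝ)) = P (w y, y 2))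
    {y : EuclideanSpace ℝ (Fin 3)} {z₀ : ℝ} (α β : ℝ)
    (hseg : ∀ t ∈ uIcc z₀ (y 2), y + (t - y 2) • (EuclideanSpace.single 2 (1 : ℝ) : EuclideanSpace ℝ (Fin 3)) ∈ U)
    (h0 : α * fderiv ℝ w (y + (z₀ - y 2) • (EuclideanSpace.single 2 (1 : ℝ) : EuclideanSpace ℝ (Fin 3))) (EuclideanSpace.single 0 (1 : ℝ)) +
        β * fderiv ℝ w (y + (z₀ - y 2) • (EuclideanSpace.single 2 (1 : ℝ) : EuclideanSpace ℝ (Fin 3))) (EuclideanSpace.single 1 (1 : ℝ)) = 0) :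
    α * fderiv ℝ w y (EuclideanSpace.single 0 (1 : ℝ)) + β * fderiv ℝ w y (EuclideanSpace.single 1 (1 : ℝ)) = 0 := by
  have hPd1 : ∀ y ∈ U, DifferentiableAt ℝ P (w y, y 2) := fun y hy => (hPd y hy).differentiableAt one_ne_zero
  have hwc : Continuous w := hw.continuous
  -- the vertical line and the pairing along it
  set e₂ : EuclideanSpace ℝ (Fin 3) := EuclideanSpace.single 2 (1 : ℝ) with he₂
  set γ : ℝ → EuclideanSpace ℝ (Fin 3) := fun t => y + (t - y 2) • e₂ with hγ
  set p : ℝ → ℝ := fun t => fderiv ℝ P (w (γ t), (γ t) 2) (1, 0) with hp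
  set φ : ℝ → ℝ := fun t => α * fderiv ℝ w (γ t) (EuclideanSpace.single 0 (1 : ℝ)) +
    β * fderiv ℝ w (γ t) (EuclideanSpace.single 1 (1 : ℝ)) with hφ
  have hγy : γ (y 2) = y := by simp [hγ]
  have hγc : Continuous γ := by
    simp only [hγ]
    fun_prop
  have hγd : ∀ t, HasDerivAt γ e₂ t := fun t => by
    rw [hγ, he₂]; exact hasDerivAt_verticalLine y t
  -- derivative of the pairing: `φ' = α ∂₂∂₀w(γ) + β ∂₂∂₁w(γ)`
  have hpart : ∀ (b : EuclideanSpace ℝ (Fin 3)) (t : ℝ),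
      HasDerivAt (fun t => fderiv ℝ w (γ t) b) (fderiv ℝ (fun y' => fderiv ℝ w y' b) (γ t) e₂) t := fun b t =>
    (differentiableAt_partial hw b (γ t)).hasFDerivAt.comp_hasDerivAt t (hγd t)
  have hφd : ∀ t, HasDerivAt φ
      (α * fderiv ℝ (fun y' => fderiv ℝ w y' (EuclideanSpace.single 0 (1 : ℝ))) (γ t) e₂ +
        β * fderiv ℝ (fun y' => fderiv ℝ w y' (EuclideanSpace.single 1 (1 : ℝ))) (γ t) e₂) t := fun t =>
    ((hpart _ t).const_mul α).add ((hpart _ t).const_mul β)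
  -- on the segment the ODE `φ' = p φ`
  have hode : ∀ t ∈ uIcc z₀ (y 2), deriv φ t = p t * φ t := by
    intro t ht
    rw [(hφd t).deriv, he₂, fderiv_vert_hpartial hU hw hPd1 hP (hseg t ht) (show (0 : Fin 3) ≠ 2 by decide),
      fderiv_vert_hpartial hU hw hPd1 hP (hseg t ht) (show (1 : Fin 3) ≠ 2 by decide)]
    simp only [hp, hφ, hγ, he₂]
    ring
  -- the coefficient `p` is continuous on the compact segment, hence bounded
  have hpc : ContinuousOn p (uIcc z₀ (y 2)) := by
    intro t ht
    have hγt : γ t ∈ U := hseg t ht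
    have h1 : ContinuousAt (fderiv ℝ P) (w (γ t), (γ t) 2) :=
      ((hPd _ hγt).fderiv_right (m := 0) le_rfl).continuousAt
    have h2 : ContinuousAt (fun t : ℝ => (w (γ t), (γ t) 2)) t :=
      (continuousAt_leafMap (hwc.continuousAt)).comp (hγc.continuousAt)
    have h3 : ContinuousAt (fun t : ℝ => fderiv ℝ P (w (γ t), (γ t) 2)) t :=
      ContinuousAt.comp (f := fun t : ℝ => (w (γ t), (γ t) 2)) (g := fderiv ℝ P) h1 h2
    exact (h3.clm_apply continuousAt_const).continuousWithinAt
  obtain ⟨K, hK⟩ := isCompact_uIcc.exists_bound_of_continuousOn hpc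
  -- Grönwall
  have hz₀ : φ z₀ = 0 := by
    simp only [hφ, hγ]
    exact h0
  have h := eq_zero_of_abs_deriv_le_mul_abs (φ := φ) (K := K) (z₀ := z₀) (z₁ := y 2)
    (fun t _ => (hφd t).differentiableAt)
    (fun t ht => by
      rw [hode t ht, abs_mul]
      exact mul_le_mul_of_nonneg_right (by simpa [Real.norm_eq_abs] using hK t ht) (abs_nonneg _)) hz₀
  simpa [hφ, hγy] using h

/-! ### F1(b): `w` is a function of its restriction to one horizontal plane and of the height -/

/-- Vertical projection does not increase the distance to a point of the target plane's height range: if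
`t ∈ [[a₂, y₂]]` then `dist (y + (t − y₂)e₂) a ≤ dist y a`. [folklore] -/
theorem dist_verticalShift_le {y a : EuclideanSpace ℝ (Fin 3)} {t : ℝ} (ht : t ∈ uIcc (a 2) (y 2)) :
    dist (y + (t - y 2) • (EuclideanSpace.single 2 (1 : ℝ) : EuclideanSpace ℝ (Fin 3))) a ≤ dist y a := by
  rw [EuclideanSpace.dist_eq, EuclideanSpace.dist_eq]
  apply Real.sqrt_le_sqrt
  simp only [Fin.sum_univ_three]
  have h0 : (y + (t - y 2) • (EuclideanSpace.single 2 (1 : ℝ) : EuclideanSpace ℝ (Fin 3))) 0 = y 0 := by simp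
  have h1 : (y + (t - y 2) • (EuclideanSpace.single 2 (1 : ℝ) : EuclideanSpace ℝ (Fin 3))) 1 = y 1 := by simp
  have h2 : (y + (t - y 2) • (EuclideanSpace.single 2 (1 : ℝ) : EuclideanSpace ℝ (Fin 3))) 2 = t := by simp
  rw [h0, h1, h2]
  have ht' : |t - a 2| ≤ |y 2 - a 2| := abs_sub_left_of_mem_uIcc ht
  have hd : dist t (a 2) ≤ dist (y 2) (a 2) := by rwa [Real.dist_eq, Real.dist_eq]
  have hsq : dist t (a 2) ^ 2 ≤ dist (y 2) (a 2) ^ 2 := pow_le_pow_left₀ dist_nonneg hd 2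
  linarith

/-- The vertical projection `♭ : y ↦ y + (z₀ − y₂)e₂` onto the plane of height `z₀` has derivative `h ↦ h − h₂e₂`; in particular
`D♭(y)[e_b] = e_b` for a horizontal index `b`. [folklore] -/
theorem hasFDerivAt_verticalProjection (z₀ : ℝ) (y : EuclideanSpace ℝ (Fin 3)) :
    HasFDerivAt (fun y' : EuclideanSpace ℝ (Fin 3) => y' + (z₀ - y' 2) • (EuclideanSpace.single 2 (1 : ℝ) : EuclideanSpace ℝ (Fin 3)))
      (ContinuousLinearMap.id ℝ (EuclideanSpace ℝ (Fin 3)) -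
        (EuclideanSpace.proj (𝕜 := ℝ) (2 : Fin 3)).smulRight (EuclideanSpace.single 2 (1 : ℝ))) y := by
  have h1 : HasFDerivAt (fun y' : EuclideanSpace ℝ (Fin 3) => z₀ - y' 2)
      (-(EuclideanSpace.proj (𝕜 := ℝ) (2 : Fin 3) : EuclideanSpace ℝ (Fin 3) →L[ℝ] ℝ)) y := by
    have h := ((EuclideanSpace.proj (𝕜 := ℝ) (2 : Fin 3)).hasFDerivAt (x := y)).const_sub z₀
    exact h
  have h2 := (hasFDerivAt_id y).add (h1.smul_const (EuclideanSpace.single 2 (1 : ℝ) : EuclideanSpace ℝ (Fin 3)))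
  refine h2.congr_fderiv ?_
  ext h i
  simp [sub_eq_add_neg]

/-- Horizontal partials of `w ∘ ♭` are the horizontal partials of `w` at the projected point. [folklore] -/
theorem fderiv_comp_verticalProjection {w : EuclideanSpace ℝ (Fin 3) → ℝ} (hw : Differentiable ℝ w) (z₀ : ℝ)
    (y : EuclideanSpace ℝ (Fin 3)) {b : Fin 3} (hb : b ≠ 2) :
    fderiv ℝ (fun y' : EuclideanSpace ℝ (Fin 3) => w (y' + (z₀ - y' 2) • (EuclideanSpace.single 2 (1 : ℝ) : EuclideanSpace ℝ (Fin 3)))) y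
        (EuclideanSpace.single b (1 : ℝ)) =
      fderiv ℝ w (y + (z₀ - y 2) • (EuclideanSpace.single 2 (1 : ℝ) : EuclideanSpace ℝ (Fin 3))) (EuclideanSpace.single b (1 : ℝ)) := by
  have hc := (hw (y + (z₀ - y 2) • (EuclideanSpace.single 2 (1 : ℝ) : EuclideanSpace ℝ (Fin 3)))).hasFDerivAt.comp y
    (hasFDerivAt_verticalProjection z₀ y)
  rw [show (fun y' : EuclideanSpace ℝ (Fin 3) => w (y' + (z₀ - y' 2) • (EuclideanSpace.single 2 (1 : ℝ) : EuclideanSpace ℝ (Fin 3)))) =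
      w ∘ fun y' : EuclideanSpace ℝ (Fin 3) => y' + (z₀ - y' 2) • (EuclideanSpace.single 2 (1 : ℝ) : EuclideanSpace ℝ (Fin 3)) from rfl,
    hc.fderiv, ContinuousLinearMap.comp_apply]
  congr 1
  simp [hb.symm]

/-- **F1(b) — an untwisted function is a function of its slice and of the height: `w = G(w ∘ ♭, y₂)`.**  Let `U` be open, `a ∈ U`,
`w ∈ Cⁿ(ℝ³)` (`2 ≤ n`, `n = ω` allowed), `∂₂w(y) = P(w(y), y₂)` on `U` with `P` of class `C¹` at the leaf points
of `U`, and `∇ₕw(a) ≠ 0`.  Then there is `G : ℝ × ℝ → ℝ`, of class `Cⁿ` at `(w a, a₂)`, with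
`w(y) = G(w(y + (a₂ − y₂)e₂), y₂)` for all `y` near `a`: on a box, `w` is determined by its restriction `u` to the plane `y₂ = a₂`
and the height (UNTWISTED-NOTE §2, kinematic lemma `w = G(u(x,y), z)`; proof: the bracket `{w, w∘♭}ₕ` vanishes on the plane and is
propagated vertically by `horizontalPairing_eq_zero_of_slice`, then `exists_comp_slice`). [folklore] -/
theorem exists_comp_sliceValue {n : WithTop ℕ∞} (hn : 2 ≤ n)
    {w : EuclideanSpace ℝ (Fin 3) → ℝ} {P : ℝ × ℝ → ℝ} {U : Set (EuclideanSpace ℝ (Fin 3))}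
    (hU : IsOpen U) (hw : ContDiff ℝ n w)
    (hPd : ∀ y ∈ U, ContDiffAt ℝ 1 P (w y, y 2))
    (hP : ∀ y ∈ U, fderiv ℝ w y (EuclideanSpace.single 2 (1 : ℝ)) = P (w y, y 2))
    {a : EuclideanSpace ℝ (Fin 3)} (ha : a ∈ U)
    (hpin : fderiv ℝ w a (EuclideanSpace.single 0 (1 : ℝ)) ≠ 0 ∨ fderiv ℝ w a (EuclideanSpace.single 1 (1 : ℝ)) ≠ 0) :
    ∃ G : ℝ × ℝ → ℝ, ContDiffAt ℝ n G (w a, a 2) ∧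
      ∀ᶠ y in 𝓝 a, w y = G (w (y + (a 2 - y 2) • (EuclideanSpace.single 2 (1 : ℝ) : EuclideanSpace ℝ (Fin 3))), y 2) := by
  have hn0 : n ≠ 0 := by
    intro h; rw [h] at hn; exact absurd hn (by norm_num)
  have hw2 : ContDiff ℝ 2 w := hw.of_le hn
  have hwd : Differentiable ℝ w := hw2.differentiable (by norm_num)
  set e₂ : EuclideanSpace ℝ (Fin 3) := EuclideanSpace.single 2 (1 : ℝ) with he₂
  -- the slice function `g = w ∘ ♭`
  set g : EuclideanSpace ℝ (Fin 3) → ℝ := fun y => w (y + (a 2 - y 2) • e₂) with hg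
  have hflat : ContDiff ℝ n (fun y : EuclideanSpace ℝ (Fin 3) => y + (a 2 - y 2) • e₂) := by
    have e : (fun y : EuclideanSpace ℝ (Fin 3) => y + (a 2 - y 2) • e₂) =
        fun y => y + (a 2 - (EuclideanSpace.proj (𝕜 := ℝ) (2 : Fin 3)) y) • e₂ := rfl
    rw [e]
    fun_prop
  have hgC : ContDiffAt ℝ n g a := (hw.comp hflat).contDiffAt
  have hga : a + (a 2 - a 2) • e₂ = a := by simp
  -- horizontal partials of `g`
  have hgb : ∀ (y : EuclideanSpace ℝ (Fin 3)) {b : Fin 3}, b ≠ 2 →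
      fderiv ℝ g y (EuclideanSpace.single b (1 : ℝ)) = fderiv ℝ w (y + (a 2 - y 2) • e₂) (EuclideanSpace.single b (1 : ℝ)) :=
    fun y b hb => by rw [hg, he₂]; exact fderiv_comp_verticalProjection hwd (a 2) y hb
  -- a ball inside `U`
  obtain ⟨δ, hδ, hball⟩ := Metric.isOpen_iff.1 hU a ha
  -- the bracket `{w, g}ₕ` vanishes on the ball
  have hbr0 : ∀ y ∈ ball a δ,
      fderiv ℝ w y (EuclideanSpace.single 0 (1 : ℝ)) * fderiv ℝ g y (EuclideanSpace.single 1 (1 : ℝ)) -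
        fderiv ℝ w y (EuclideanSpace.single 1 (1 : ℝ)) * fderiv ℝ g y (EuclideanSpace.single 0 (1 : ℝ)) = 0 := by
    intro y hy
    rw [hgb y (show (1 : Fin 3) ≠ 2 by decide), hgb y (show (0 : Fin 3) ≠ 2 by decide)]
    have hseg : ∀ t ∈ uIcc (a 2) (y 2), y + (t - y 2) • e₂ ∈ U := fun t ht =>
      hball (lt_of_le_of_lt (by rw [he₂]; exact dist_verticalShift_le ht) (mem_ball.1 hy))
    have h := horizontalPairing_eq_zero_of_slice hU hw2 hPd hP (y := y) (z₀ := a 2)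
      (fderiv ℝ w (y + (a 2 - y 2) • e₂) (EuclideanSpace.single 1 (1 : ℝ)))
      (-fderiv ℝ w (y + (a 2 - y 2) • e₂) (EuclideanSpace.single 0 (1 : ℝ))) hseg (by rw [he₂]; ring)
    rw [he₂] at h ⊢
    linear_combination h
  have hbrN : ∀ᶠ y in 𝓝 a,
      fderiv ℝ w y (EuclideanSpace.single 0 (1 : ℝ)) * fderiv ℝ g y (EuclideanSpace.single 1 (1 : ℝ)) -
        fderiv ℝ w y (EuclideanSpace.single 1 (1 : ℝ)) * fderiv ℝ g y (EuclideanSpace.single 0 (1 : ℝ)) = 0 :=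
    eventually_of_mem (ball_mem_nhds a hδ) hbr0
  -- functional dependence, pivoting on the non-zero horizontal partial of `g` at `a`
  rcases hpin with h0 | h1
  · have hpin' : fderiv ℝ g a (EuclideanSpace.single 0 1) ≠ 0 := by
      rw [hgb a (show (0 : Fin 3) ≠ 2 by decide), hga]; exact h0
    obtain ⟨G, hG, hGeq⟩ := exists_comp_slice hn0 (b₀ := 0) (b₁ := 1) (by decide) (by decide) (by decide)
      hw.contDiffAt hgC hpin' (hbrN.mono fun y hy => by linear_combination hy)
    refine ⟨G, ?_, hGeq⟩
    have e : g a = w a := by simp [hg]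
    rw [← e]; exact hG
  · have hpin' : fderiv ℝ g a (EuclideanSpace.single 1 1) ≠ 0 := by
      rw [hgb a (show (1 : Fin 3) ≠ 2 by decide), hga]; exact h1
    obtain ⟨G, hG, hGeq⟩ := exists_comp_slice hn0 (b₀ := 1) (b₁ := 0) (by decide) (by decide) (by decide)
      hw.contDiffAt hgC hpin' (hbrN.mono fun y hy => by linear_combination -hy)
    refine ⟨G, ?_, hGeq⟩
    have e : g a = w a := by simp [hg]
    rw [← e]; exact hG

end Summit.NavierStokesRegularity.NavierStokesRegularity.Theorems.PoloidalWindowDoorPoloidalWindowRigidityUntwistedKinematics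

end
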